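import Summits.ResolutionOfSingularities.ResolutionOfSingularities.Theorems.WeightedInvariantIota3TauDescentAdmTools
import HarnessLib

/-!
# (desc-τ), CASE B: THE INDUCTION STEP OF (ADAPT-adm) — correcting an rsp-adapted generator of `P₀` along the transversal parameter
# (door `HypersurfaceCentreConstruction`, stmt-ResolutionOfSingularities-19897; gap (1) (desc-τ) of the P3 rung `stub_keyRungGrHomLE_three`)

Topic: `Summits/ResolutionOfSingularities/ResolutionOfSingularities/Theorems`. Helper for the door item `HypersurfaceCentreConstruction`
(stmt-ResolutionOfSingularities-19897, route `WeightedInvariant`), line `local-engine`, def-free.  …Iota3TauDescentDoorAdm reduced (desc-τ) in the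
door setting to (ADAPT-adm): «given the Abramovich–Quek–Schober order variable `y₁ ∈ O = T_{P₀}` of `(g/1)` with `g/1 ∈ 𝒥_{rν}((y₁, ·); (r, q))`,
`q < r`, some generator `Y` of `P₀ = (X₀, Y)` completing to a regular system of parameters of `T` has `Y/1 ∈ (y₁, X₀^m) O` for the least `m` with
`m q ≥ r`».  THIS FILE proves the INDUCTION STEP of the blueprint (memo TAU-DESCENT-A.md §7 (ii)):

  **`Iota3.exists_sub_mul_pow_mem_span`** — `T` regular local of dimension three, `P = (X₀, Y)` a prime with `T ⧸ P` regular of dimension one and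
  `dim T_P = 2`, `Y ∉ 𝔪_T²`; `g ∈ P^ν ∖ 𝔪_T^{ν+1}` (`ν ≥ 1`), `g/1 ∈ 𝒥_{rν}((y₁, X₀/1); (r, q))` in `O = T_P`, `2 ≤ k`, `k q < r`, and
  `Y/1 ∈ (y₁, X₀^k) O`.  Then `(Y - c X₀^k)/1 ∈ (y₁, X₀^{k+1}) O` for some `c ∈ T` (tools: `algebraMap_sub_mul_pow_mem_span`,
  `mem_maximalIdeal_of_mul_pow_mem` = two-dimensional quasi-regularity, `exists_dvd_of_prime_pow_succ_dvd`).

Proof (reduction modulo `Y`, normality of the discrete valuation ring `T ⧸ P`).  Write `Y/1 = a y₁ + γ X₀^k` (`a` a unit as `Y/1 ∉ 𝔪_O²`) and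
`γ = γ_T / s`.  In `D = T ⧸ P` (a DVR, uniformizer `ϖ = z̄₀`) `s̄ = unit·ϖ^{n_s}`, `γ̄_T = unit·ϖ^{n_t}` (or `0`); if `γ_T ∈ P` or `n_s ≤ n_t` then
`γ ≡ c (mod 𝔪_O)` for some `c ∈ T` and `Y - c X₀^k` works.  Otherwise `z₀ⁿ γ ≡ u (mod 𝔪_O)` with `n ≥ 1`, `u ∈ T^×`; expanding
`g/1 ∈ 𝒥_{rν}((y₁, X₀); (r, q))` along `y₁ = a⁻¹(Y - γ X₀^k)` (every monomial other than `y₁^ν` has ordinary degree `≥ ν + 1` and `(k,1)`-degree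
`≥ kν + 1`, because `q < r` and `kq < r`) gives `g/1 ≡ c₀ a^{-ν} Y^ν (mod 𝔪_O^{ν+1})` and `g/1 ≡ c₀ a^{-ν} (-γ)^ν X₀^{kν} (mod (Y, X₀^{kν+1}) O)`;
writing `g = g₀ Y^ν + h₀ X₀` in `T` (`g ∈ P^ν`), two-dimensional quasi-regularity at `O` gives `c₀ a^{-ν} ≡ g₀ (mod 𝔪_O)` and `h₀ X₀ ∈ 𝔪_O^{ν+1} ∩ T =
P^{ν+1}`, so `g₀ ∈ T^×` (as `g ∉ 𝔪_T^{ν+1}`).  Hence `W = z₀^{nν} g - g₀ (-u)^ν X₀^{kν}` has `s' W ∈ (Y, X₀^{kν+1}) T` for some `s' ∉ P`; in the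
domain `T ⧸ (Y)` with prime element `π = X̄₀` this reads `π^{kν+1} ∣ s̄'(z̄₀^{nν} ḡ - Ū π^{kν})`, whence `π^{kν} ∣ ḡ` and `π ∣ z̄₀^{nν} w̄ - Ū` — so the
unit `g₀ (-u)^ν` lies in `P + z₀ T ⊆ 𝔪_T`, a contradiction.

[OURS · L1 W4.3 · (desc-τ) case B, (ADAPT-adm) induction step]  Replaces the role of NO printed item; NOT a statement of the manuscript under review
[claim: Hironaka2017, status: under-review]; candidates stay candidates; AI work, weaker than expert review.  No definition; no axiom.

## References

* D. Abramovich, M. H. Quek, B. Schober, arXiv:2507.01232 (2025), Thm 3.5. [AbramovichQuekSchober2025]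
* H. Matsumura, *Commutative Ring Theory* (1986), Thm. 11.2, Thm. 14.2, Thm. 14.3, Thm. 16.2. [Matsumura1987]
-/

noncomputable section

set_option linter.dupNamespace false -- mandated namespace `Summit.<Summit>.<Problem>` of this single-conjunct summit

open IsLocalRing Literature.AlgebraicGeometry.Resolution
open Summit.ResolutionOfSingularities.ResolutionOfSingularities.Theorems
open Summit.ResolutionOfSingularities.ResolutionOfSingularities.Theorems.ContactCylinder

namespace Summit.ResolutionOfSingularities.ResolutionOfSingularities.Cruxes.HypersurfaceCentreConstruction.LocalEngine

namespace Iota3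
/-! ## The induction step -/

section Step

variable {T : Type} [CommRing T] [IsRegularLocalRing T]

/-- **THE INDUCTION STEP OF (ADAPT-adm).**  See the module docstring. [OURS · (desc-τ) case B]
[cite: AbramovichQuekSchober2025, Thm 3.5] [cite: Matsumura1987, Thm. 11.2, Thm. 14.2, Thm. 16.2] -/
theorem exists_sub_mul_pow_mem_span (P : Ideal T) [P.IsPrime] [hreg : IsRegularLocalRing (T ⧸ P)]
    (hP1 : ringKrullDim (T ⧸ P) = 1) (hdimO : ringKrullDim (Localization.AtPrime P) = (2 : ℕ))
    {X₀ Y : T} (hXY : Ideal.span {X₀, Y} = P) (hY2 : Y ∉ maximalIdeal T ^ 2)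
    {g : T} {ν : ℕ} (hν : 1 ≤ ν) (hgP : g ∈ P ^ ν) (hgν1 : g ∉ maximalIdeal T ^ (ν + 1))
    {y₁ : Localization.AtPrime P} {q r : ℕ}
    (hadm : algebraMap T (Localization.AtPrime P) g ∈
      weightedMonomialIdeal ![y₁, algebraMap T (Localization.AtPrime P) X₀] ![r, q] (r * ν))
    {k : ℕ} (hk : 2 ≤ k) (hkq : k * q < r)
    (hYk : algebraMap T (Localization.AtPrime P) Y ∈ Ideal.span {y₁, algebraMap T (Localization.AtPrime P) X₀ ^ k}) :
    ∃ c : T, algebraMap T (Localization.AtPrime P) (Y - c * X₀ ^ k) ∈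
      Ideal.span {y₁, algebraMap T (Localization.AtPrime P) X₀ ^ (k + 1)} := by
  classical
  set φ := algebraMap T (Localization.AtPrime P) with hφ
  haveI : IsRegularLocalRing (Localization.AtPrime P) := isRegularLocalRing_localization_atPrime T P
  haveI := isDomain_of_isRegularLocalRing T
  haveI := isDomain_of_isRegularLocalRing (Localization.AtPrime P)
  -- memberships
  have hX₀P : X₀ ∈ P := hXY ▸ Ideal.subset_span (Set.mem_insert _ _)
  have hYP : Y ∈ P := hXY ▸ Ideal.subset_span (Set.mem_insert_of_mem _ (Set.mem_singleton _))
  have hPle : P ≤ maximalIdeal T := IsLocalRing.le_maximalIdeal (Ideal.IsPrime.ne_top inferInstance)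
  have h𝔪O : Ideal.span {φ X₀, φ Y} = maximalIdeal (Localization.AtPrime P) := by
    rw [← map_span_pair, hXY, Localization.AtPrime.map_eq_maximalIdeal]
  have hφX𝔪 : φ X₀ ∈ maximalIdeal (Localization.AtPrime P) := h𝔪O ▸ Ideal.subset_span (Set.mem_insert _ _)
  have hφY𝔪 : φ Y ∈ maximalIdeal (Localization.AtPrime P) := h𝔪O ▸ Ideal.subset_span (Set.mem_insert_of_mem _ (Set.mem_singleton _))
  obtain ⟨-, hφY2⟩ := LocalGameEFTSteepening.not_mem_sq_of_span_pair_eq hdimO h𝔪O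
  -- the trivial case `y₁ ∈ (Localization.AtPrime P)^×`
  by_cases hy₁u : IsUnit y₁
  · refine ⟨0, ?_⟩
    rw [Ideal.eq_top_of_isUnit_mem _ (Ideal.subset_span (Set.mem_insert _ _)) hy₁u]
    exact Submodule.mem_top
  have hy₁𝔪 : y₁ ∈ maximalIdeal (Localization.AtPrime P) := (IsLocalRing.mem_maximalIdeal _).mpr (mem_nonunits_iff.mpr hy₁u)
  -- S1/S2: `Y/1 = a y₁ + γ X₀^k`, `a` a unit
  obtain ⟨a, γ, haγ⟩ := Ideal.mem_span_pair.mp hYk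
  have hau : IsUnit a := by
    by_contra hau
    have ha𝔪 : a ∈ maximalIdeal (Localization.AtPrime P) := (IsLocalRing.mem_maximalIdeal _).mpr (mem_nonunits_iff.mpr hau)
    apply hφY2
    rw [← haγ]
    refine Ideal.add_mem _ (by rw [pow_two]; exact Ideal.mul_mem_mul ha𝔪 hy₁𝔪)
      (Ideal.mul_mem_left _ γ (Ideal.pow_le_pow_right hk (Ideal.pow_mem_pow hφX𝔪 k)))
  obtain ⟨a, rfl⟩ := hau
  have hy₁eq : y₁ = ↑a⁻¹ * (φ Y - γ * φ X₀ ^ k) := by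
    rw [← haγ, add_sub_cancel_right, ← mul_assoc, Units.inv_mul, one_mul]
  -- the binomial remainder `(Y - γX^k)^m = Y t + (-γ)^m X^{km}`
  have hbinom : ∀ m : ℕ, ∃ t : (Localization.AtPrime P), (φ Y - γ * φ X₀ ^ k) ^ m = φ Y * t + (-γ) ^ m * φ X₀ ^ (k * m) := fun m => by
    obtain ⟨t, ht⟩ := sub_dvd_pow_sub_pow (φ Y - γ * φ X₀ ^ k) (-γ * φ X₀ ^ k) m
    refine ⟨t, ?_⟩
    have h1 : φ Y - γ * φ X₀ ^ k - -γ * φ X₀ ^ k = φ Y := by ring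
    rw [h1] at ht
    rw [pow_mul, ← mul_pow, ← ht]
    ring
  -- S6.1: decomposition of the admissibility along the generators
  set L : Ideal (Localization.AtPrime P) := Ideal.span {φ Y, φ X₀ ^ (k * ν + 1)} with hL
  set K : Ideal (Localization.AtPrime P) := maximalIdeal (Localization.AtPrime P) ^ (ν + 1) ⊓ L with hK
  have hdec : ∃ c₀ : (Localization.AtPrime P), φ g - c₀ * y₁ ^ ν ∈ K := by
    rw [weightedMonomialIdeal] at hadm
    refine Submodule.span_induction (p := fun w _ => ∃ c₀ : (Localization.AtPrime P), w - c₀ * y₁ ^ ν ∈ K) ?_ ?_ ?_ ?_ hadm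
    · rintro w ⟨α, hα, rfl⟩
      simp only [Fin.sum_univ_two, Fin.prod_univ_two, Matrix.cons_val_zero, Matrix.cons_val_one] at hα ⊢
      by_cases hα0 : α 0 = ν ∧ α 1 = 0
      · refine ⟨1, ?_⟩
        rw [hα0.1, hα0.2, pow_zero, mul_one, one_mul, sub_self]
        exact Ideal.zero_mem _
      · -- the two degree estimates
        have hdeg : ν + 1 ≤ α 0 + α 1 := by
          by_contra hlt
          push Not at hlt
          by_cases h0 : ν ≤ α 0
          · exact hα0 ⟨by omega, by omega⟩
          · push Not at h0
            have h1 : r * ν ≤ r * α 0 + q * α 1 := hα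
            have hsplit : r * ν = r * α 0 + r * (ν - α 0) := by rw [← Nat.mul_add]; congr 1; omega
            have h3 : r * (ν - α 0) ≤ q * α 1 := by omega
            have h2 : q * α 1 ≤ q * (ν - α 0) := Nat.mul_le_mul_left _ (by omega)
            have h4 : 0 < ν - α 0 := by omega
            have h5 : r ≤ q := Nat.le_of_mul_le_mul_right (h3.trans h2) h4
            have h6 : 2 * q ≤ k * q := Nat.mul_le_mul_right q hk
            omega
        have hkdeg : k * ν + 1 ≤ k * α 0 + α 1 := by
          by_cases h0 : ν ≤ α 0
          · rcases (show α 0 = ν ∨ ν + 1 ≤ α 0 by omega) with h | h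
            · have : α 1 ≠ 0 := fun h' => hα0 ⟨h, h'⟩
              rw [h]; omega
            · have := Nat.mul_le_mul_left k h
              rw [Nat.mul_succ] at this
              omega
          · push Not at h0
            have h1 : r * ν ≤ r * α 0 + q * α 1 := hα
            have hsplit : r * ν = r * α 0 + r * (ν - α 0) := by rw [← Nat.mul_add]; congr 1; omega
            have h3 : r * (ν - α 0) ≤ q * α 1 := by omega
            have h4 : k * q * (ν - α 0) < r * (ν - α 0) := Nat.mul_lt_mul_of_pos_right hkq (by omega)
            have h5 : q * (k * (ν - α 0)) < q * α 1 := by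
              calc q * (k * (ν - α 0)) = k * q * (ν - α 0) := by ring
                _ < r * (ν - α 0) := h4
                _ ≤ q * α 1 := h3
            have h6 : k * (ν - α 0) < α 1 := Nat.lt_of_mul_lt_mul_left h5
            have hsplit' : k * ν = k * α 0 + k * (ν - α 0) := by rw [← Nat.mul_add]; congr 1; omega
            omega
        refine ⟨0, ?_⟩
        rw [zero_mul, sub_zero]
        refine ⟨?_, ?_⟩
        · -- ordinary degree
          have h1 : y₁ ^ α 0 * φ X₀ ^ α 1 ∈ maximalIdeal (Localization.AtPrime P) ^ (α 0 + α 1) := by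
            rw [pow_add]; exact Ideal.mul_mem_mul (Ideal.pow_mem_pow hy₁𝔪 _) (Ideal.pow_mem_pow hφX𝔪 _)
          exact Ideal.pow_le_pow_right hdeg h1
        · -- `(k, 1)`-degree
          obtain ⟨t, ht⟩ := hbinom (α 0)
          obtain ⟨d, hd⟩ := Nat.exists_eq_add_of_le hkdeg
          have : y₁ ^ α 0 * φ X₀ ^ α 1 = (↑a⁻¹ ^ α 0 * t * φ X₀ ^ α 1) * φ Y +
              (↑a⁻¹ ^ α 0 * (-γ) ^ α 0 * φ X₀ ^ d) * φ X₀ ^ (k * ν + 1) := by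
            have hpow : φ X₀ ^ (k * α 0) * φ X₀ ^ α 1 = φ X₀ ^ d * φ X₀ ^ (k * ν + 1) := by
              rw [← pow_add, ← pow_add, hd, Nat.add_comm]
            rw [hy₁eq, mul_pow, ht]
            linear_combination (↑a⁻¹ : (Localization.AtPrime P)) ^ α 0 * (-γ) ^ α 0 * hpow
          rw [this]
          exact Ideal.mem_span_pair.mpr ⟨_, _, rfl⟩
    · exact ⟨0, by rw [zero_mul, sub_zero]; exact Ideal.zero_mem _⟩
    · rintro w₁ w₂ - - ⟨c₁, h₁⟩ ⟨c₂, h₂⟩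
      refine ⟨c₁ + c₂, ?_⟩
      have : w₁ + w₂ - (c₁ + c₂) * y₁ ^ ν = (w₁ - c₁ * y₁ ^ ν) + (w₂ - c₂ * y₁ ^ ν) := by ring
      rw [this]; exact Ideal.add_mem _ h₁ h₂
    · rintro t w - ⟨c₁, h₁⟩
      refine ⟨t * c₁, ?_⟩
      have : t • w - t * c₁ * y₁ ^ ν = t * (w - c₁ * y₁ ^ ν) := by rw [smul_eq_mul]; ring
      rw [this]; exact Ideal.mul_mem_left _ _ h₁
  obtain ⟨c₀, hc₀𝔪, hc₀L⟩ := hdec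
  -- (ii) `g/1 ≡ c₀ a^{-ν} Y^ν (mod 𝔪^{ν+1})`
  obtain ⟨ν', hν'⟩ : ∃ ν', ν = ν' + 1 := ⟨ν - 1, by omega⟩
  have hdiff : (φ Y - γ * φ X₀ ^ k) ^ ν - φ Y ^ ν ∈ maximalIdeal (Localization.AtPrime P) ^ (ν + 1) := by
    have hAB : (φ Y - γ * φ X₀ ^ k) - φ Y ∈ maximalIdeal (Localization.AtPrime P) ^ 2 := by
      rw [sub_sub_cancel_left]
      exact neg_mem (Ideal.mul_mem_left _ γ (Ideal.pow_le_pow_right hk (Ideal.pow_mem_pow hφX𝔪 k)))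
    have hA : φ Y - γ * φ X₀ ^ k ∈ maximalIdeal (Localization.AtPrime P) := Ideal.sub_mem _ hφY𝔪 (Ideal.mul_mem_left _ γ
      (Ideal.pow_mem_of_mem _ hφX𝔪 _ (by omega)))
    have h := pow_sub_pow_mem_mul_pow hAB hA hφY𝔪 ν'
    rw [← pow_add, show 2 + ν' = ν + 1 by omega, ← hν'] at h
    exact h
  have hii : φ g - c₀ * ↑a⁻¹ ^ ν * φ Y ^ ν ∈ maximalIdeal (Localization.AtPrime P) ^ (ν + 1) := by
    have : φ g - c₀ * ↑a⁻¹ ^ ν * φ Y ^ ν =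
        (φ g - c₀ * y₁ ^ ν) + c₀ * ↑a⁻¹ ^ ν * ((φ Y - γ * φ X₀ ^ k) ^ ν - φ Y ^ ν) := by
      rw [hy₁eq, mul_pow]; ring
    rw [this]
    exact Ideal.add_mem _ hc₀𝔪 (Ideal.mul_mem_left _ _ hdiff)
  -- (iii) `g = h₀ X₀ + g₀ Y^ν` in `T`
  have hgP' : g ∈ Ideal.span ({X₀, Y ^ ν} : Set T) := by
    rw [← hXY] at hgP
    exact span_pair_pow_le_span_pair_pow X₀ Y ν hgP
  obtain ⟨h₀, g₀, hg⟩ := Ideal.mem_span_pair.mp hgP'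
  have hφg : φ g = φ h₀ * φ X₀ + φ g₀ * φ Y ^ ν := by rw [← hg, map_add, map_mul, map_mul, map_pow]
  -- (iv) `c₀ a^{-ν} ≡ g₀ (mod 𝔪_O)`
  have hlam : c₀ * ↑a⁻¹ ^ ν - φ g₀ ∈ maximalIdeal (Localization.AtPrime P) := by
    refine mem_maximalIdeal_of_mul_pow_mem hdimO h𝔪O (ν := ν) ?_
    have : (c₀ * ↑a⁻¹ ^ ν - φ g₀) * φ Y ^ ν = φ h₀ * φ X₀ + -(φ g - c₀ * ↑a⁻¹ ^ ν * φ Y ^ ν) := by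
      rw [hφg]; ring
    rw [this]
    exact Ideal.add_mem _ (Ideal.mem_sup_left (Ideal.mul_mem_left _ _ (Ideal.mem_span_singleton_self _)))
      (Ideal.mem_sup_right (neg_mem hii))
  -- (v) `g₀` is a unit of `T`
  have hv : φ (h₀ * X₀) ∈ maximalIdeal (Localization.AtPrime P) ^ (ν + 1) := by
    have : φ (h₀ * X₀) = (φ g - c₀ * ↑a⁻¹ ^ ν * φ Y ^ ν) + (c₀ * ↑a⁻¹ ^ ν - φ g₀) * φ Y ^ ν := by
      rw [map_mul, hφg]; ring
    rw [this]
    refine Ideal.add_mem _ hii ?_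
    rw [pow_succ']
    exact Ideal.mul_mem_mul hlam (Ideal.pow_mem_pow hφY𝔪 ν)
  have hvT : h₀ * X₀ ∈ P ^ (ν + 1) := by
    rw [← EquimultipleCentre.comap_map_pow_eq P P le_rfl (ν + 1), Ideal.mem_comap, Ideal.map_pow,
      Localization.AtPrime.map_eq_maximalIdeal]
    exact hv
  have hg₀u : IsUnit g₀ := by
    by_contra hg₀
    have hg₀𝔪 : g₀ ∈ maximalIdeal T := (IsLocalRing.mem_maximalIdeal _).mpr (mem_nonunits_iff.mpr hg₀)
    apply hgν1
    rw [← hg]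
    refine Ideal.add_mem _ (Ideal.pow_right_mono hPle _ hvT) ?_
    rw [pow_succ']
    exact Ideal.mul_mem_mul hg₀𝔪 (Ideal.pow_mem_pow (hPle hYP) ν)
  -- (vi) `g/1 ≡ g₀ (-γ)^ν X₀^{kν} (mod L)`
  have hmulL : ∀ m ∈ maximalIdeal (Localization.AtPrime P), ∀ e : (Localization.AtPrime P), m * e * φ X₀ ^ (k * ν) ∈ L := by
    intro m hm e
    rw [← h𝔪O] at hm
    obtain ⟨lam, μ, rfl⟩ := Ideal.mem_span_pair.mp hm
    have : (lam * φ X₀ + μ * φ Y) * e * φ X₀ ^ (k * ν) =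
        (μ * e * φ X₀ ^ (k * ν)) * φ Y + (lam * e) * φ X₀ ^ (k * ν + 1) := by ring
    rw [this]
    exact Ideal.mem_span_pair.mpr ⟨_, _, rfl⟩
  have hYL : ∀ e : (Localization.AtPrime P), φ Y * e ∈ L := fun e =>
    Ideal.mul_mem_right _ _ (Ideal.subset_span (Set.mem_insert _ _))
  have hvi : φ g - φ g₀ * (-γ) ^ ν * φ X₀ ^ (k * ν) ∈ L := by
    obtain ⟨t, ht⟩ := hbinom ν
    have : φ g - φ g₀ * (-γ) ^ ν * φ X₀ ^ (k * ν) = (φ g - c₀ * y₁ ^ ν) + φ Y * (c₀ * ↑a⁻¹ ^ ν * t) +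
        (c₀ * ↑a⁻¹ ^ ν - φ g₀) * (-γ) ^ ν * φ X₀ ^ (k * ν) := by
      rw [hy₁eq, mul_pow, ht]; ring
    rw [this]
    exact Ideal.add_mem _ (Ideal.add_mem _ hc₀L (hYL _)) (hmulL _ hlam _)
  -- S4: `γ = γ_T / s`
  obtain ⟨⟨γT, s⟩, hγ⟩ := IsLocalization.surj P.primeCompl γ
  have hsu : IsUnit (φ (s : T)) := IsLocalization.map_units (Localization.AtPrime P) s
  have hsP : (s : T) ∉ P := s.2
  -- S5: normal forms in the DVR `T ⧸ P`
  haveI := isDomain_of_isRegularLocalRing (T ⧸ P)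
  haveI : IsDiscreteValuationRing (T ⧸ P) :=
    Literature.RingTheory.RegularLocalRing.isDiscreteValuationRing_of_ringKrullDim_eq_one hP1
  haveI : IsLocalHom (Ideal.Quotient.mk P) := IsLocalHom.of_surjective _ Ideal.Quotient.mk_surjective
  obtain ⟨ϖ, hϖ⟩ := IsDiscreteValuationRing.exists_irreducible (T ⧸ P)
  obtain ⟨z₀, hz₀⟩ := Ideal.Quotient.mk_surjective ϖ
  have hz₀P : z₀ ∉ P := fun h => hϖ.ne_zero (by rw [← hz₀, Ideal.Quotient.eq_zero_iff_mem.mpr h])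
  have hz₀𝔪 : z₀ ∈ maximalIdeal T := by
    refine (IsLocalRing.mem_maximalIdeal _).mpr (mem_nonunits_iff.mpr fun hu => hϖ.not_isUnit ?_)
    rw [← hz₀]; exact hu.map _
  have hlift : ∀ w : T ⧸ P, IsUnit w → ∃ b : T, IsUnit b ∧ Ideal.Quotient.mk P b = w := by
    intro w hw
    obtain ⟨b, rfl⟩ := Ideal.Quotient.mk_surjective w
    exact ⟨b, isUnit_of_map_unit (Ideal.Quotient.mk P) b hw, rfl⟩
  -- `γ - c/1 ∈ 𝔪_O` from a congruence modulo `P`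
  have hγ' : γ = φ γT * ↑hsu.unit⁻¹ := by
    rw [← hγ, mul_assoc, IsUnit.mul_val_inv, mul_one]
  have hcong : ∀ (e c : T), e * γT - c * s ∈ P → φ e * γ - φ c ∈ maximalIdeal (Localization.AtPrime P) := by
    intro e c h
    have : φ e * γ - φ c = φ (e * γT - c * s) * ↑hsu.unit⁻¹ := by
      rw [map_sub, map_mul, map_mul, hγ', sub_mul, mul_assoc, mul_assoc (φ c), IsUnit.mul_val_inv, mul_one]
    rw [this, ← Localization.AtPrime.map_eq_maximalIdeal]
    exact Ideal.mul_mem_right _ _ (Ideal.mem_map_of_mem _ h)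
  have hs0 : Ideal.Quotient.mk P (s : T) ≠ 0 := fun h => hsP (Ideal.Quotient.eq_zero_iff_mem.mp h)
  obtain ⟨ns, ws, hws, hsn⟩ := exists_unit_mul_pow_of_ne_zero hϖ hs0
  obtain ⟨bs, hbs, hbsw⟩ := hlift ws hws
  have hbs1 : Ideal.Quotient.mk P (↑hbs.unit⁻¹ : T) * ws = 1 := by
    rw [← hbsw, ← map_mul, IsUnit.val_inv_mul, map_one]
  -- case `γ_T ∈ P`: `c = 0`
  by_cases hγTP : γT ∈ P
  · refine ⟨0, algebraMap_sub_mul_pow_mem_span P hXY (by omega) haγ ?_⟩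
    have h := hcong 1 0 (by rw [one_mul, zero_mul, sub_zero]; exact hγTP)
    rw [map_one, one_mul] at h
    exact h
  have ht0 : Ideal.Quotient.mk P γT ≠ 0 := fun h => hγTP (Ideal.Quotient.eq_zero_iff_mem.mp h)
  obtain ⟨nt, wt, hwt, htn⟩ := exists_unit_mul_pow_of_ne_zero hϖ ht0
  obtain ⟨bt, hbt, hbtw⟩ := hlift wt hwt
  by_cases hle : ns ≤ nt
  · -- `c = b_t b_s⁻¹ z₀^{n_t - n_s}`
    refine ⟨bt * ↑hbs.unit⁻¹ * z₀ ^ (nt - ns), algebraMap_sub_mul_pow_mem_span P hXY (by omega) haγ ?_⟩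
    have h := hcong 1 (bt * ↑hbs.unit⁻¹ * z₀ ^ (nt - ns)) (by
      rw [← Ideal.Quotient.eq_zero_iff_mem]
      simp only [map_sub, map_mul, map_pow, one_mul, htn, hz₀, hbtw, hsn]
      rw [sub_eq_zero]
      calc wt * ϖ ^ nt = wt * (Ideal.Quotient.mk P (↑hbs.unit⁻¹ : T) * ws) * (ϖ ^ (nt - ns) * ϖ ^ ns) := by
            rw [hbs1, mul_one, ← pow_add, Nat.sub_add_cancel hle]
        _ = wt * Ideal.Quotient.mk P (↑hbs.unit⁻¹ : T) * ϖ ^ (nt - ns) * (ws * ϖ ^ ns) := by ring)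
    rwa [map_one, one_mul] at h
  · -- `n_t < n_s`: contradiction
    exfalso
    push Not at hle
    set n := ns - nt with hn
    have hn1 : 1 ≤ n := by omega
    set u : T := bt * ↑hbs.unit⁻¹ with hudef
    have huu : IsUnit u := hbt.mul (Units.isUnit _)
    have hzγ : φ (z₀ ^ n) * γ - φ u ∈ maximalIdeal (Localization.AtPrime P) := hcong (z₀ ^ n) u (by
      rw [← Ideal.Quotient.eq_zero_iff_mem, hudef]
      simp only [map_sub, map_mul, map_pow, htn, hz₀, hbtw, hsn]
      rw [sub_eq_zero]
      calc ϖ ^ n * (wt * ϖ ^ nt) = wt * (Ideal.Quotient.mk P (↑hbs.unit⁻¹ : T) * ws) * (ϖ ^ n * ϖ ^ nt) := by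
            rw [hbs1, mul_one]; ring
        _ = wt * Ideal.Quotient.mk P (↑hbs.unit⁻¹ : T) * (ws * ϖ ^ ns) := by
            rw [← pow_add, show n + nt = ns by omega]; ring)
    -- (vii) `W = z₀^{nν} g - g₀ (-u)^ν X₀^{kν}` has `W/1 ∈ L`
    set W : T := z₀ ^ (n * ν) * g - g₀ * (-u) ^ ν * X₀ ^ (k * ν) with hWdef
    have hWL : φ W ∈ L := by
      obtain ⟨t, ht⟩ := sub_dvd_pow_sub_pow (-(φ (z₀ ^ n) * γ)) (-φ u) ν
      have hmem : (-(φ (z₀ ^ n) * γ)) ^ ν - (-φ u) ^ ν ∈ maximalIdeal (Localization.AtPrime P) := by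
        rw [ht, show -(φ (z₀ ^ n) * γ) - -φ u = -(φ (z₀ ^ n) * γ - φ u) by ring]
        exact Ideal.mul_mem_right _ _ (neg_mem hzγ)
      have : φ W = φ (z₀ ^ n) ^ ν * (φ g - φ g₀ * (-γ) ^ ν * φ X₀ ^ (k * ν)) +
          ((-(φ (z₀ ^ n) * γ)) ^ ν - (-φ u) ^ ν) * φ g₀ * φ X₀ ^ (k * ν) := by
        rw [hWdef]
        simp only [map_sub, map_mul, map_pow, map_neg]
        ring
      rw [this]
      exact Ideal.add_mem _ (Ideal.mul_mem_left _ _ hvi) (hmulL _ hmem _)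
    -- clear denominators: `s' W ∈ (Y, X₀^{kν+1}) T`
    have hLmap : L = (Ideal.span ({Y, X₀ ^ (k * ν + 1)} : Set T)).map φ := by
      rw [map_span_pair, map_pow]
    rw [hLmap, IsLocalization.mem_map_algebraMap_iff P.primeCompl (Localization.AtPrime P)] at hWL
    obtain ⟨⟨⟨i, hi⟩, s₂⟩, hs₂⟩ := hWL
    obtain ⟨c₃, hc₃⟩ := (IsLocalization.eq_iff_exists P.primeCompl (Localization.AtPrime P)).mp
      (show φ (W * (s₂ : T)) = φ i by rw [map_mul]; exact hs₂)
    have hs'P : (c₃ : T) * (s₂ : T) ∉ P := fun h =>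
      ((inferInstance : P.IsPrime).mem_or_mem h).elim c₃.2 s₂.2
    have hs'W : ((c₃ : T) * (s₂ : T)) * W ∈ Ideal.span ({Y, X₀ ^ (k * ν + 1)} : Set T) := by
      have : ((c₃ : T) * (s₂ : T)) * W = ↑c₃ * (W * ↑s₂) := by ring
      rw [this, hc₃]
      exact Ideal.mul_mem_left _ _ hi
    -- (viii) pass to `T₂ = T ⧸ (Y)`
    set mk₂ := Ideal.Quotient.mk (Ideal.span ({Y} : Set T)) with hmk₂
    obtain ⟨hreg₂, -⟩ := IsRegularLocalRing.quotient_span_singleton (hPle hYP) hY2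
    haveI := hreg₂
    haveI := isDomain_of_isRegularLocalRing (T ⧸ Ideal.span ({Y} : Set T))
    have hker : RingHom.ker mk₂ ≤ P := by
      rw [hmk₂, Ideal.mk_ker, Ideal.span_singleton_le_iff_mem]; exact hYP
    have hY0 : mk₂ Y = 0 := Ideal.Quotient.eq_zero_iff_mem.mpr (Ideal.mem_span_singleton_self Y)
    have hPmap : P.map mk₂ = Ideal.span {mk₂ X₀} := by
      rw [← hXY, map_span_pair, hY0, Set.pair_comm, Ideal.span_insert_zero]
    haveI hπI : (Ideal.span {mk₂ X₀}).IsPrime := hPmap ▸ Ideal.map_isPrime_of_surjective Ideal.Quotient.mk_surjective hker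
    have hdvd_iff : ∀ t : T, mk₂ X₀ ∣ mk₂ t ↔ t ∈ P := fun t => by
      rw [← Ideal.mem_span_singleton, ← hPmap, ← Ideal.mem_comap, Ideal.comap_map_of_surjective _ Ideal.Quotient.mk_surjective,
        ← RingHom.ker_eq_comap_bot, sup_eq_left.mpr hker]
    have hπ0 : mk₂ X₀ ≠ 0 := fun h0 => by
      have : X₀ ∈ Ideal.span ({Y} : Set T) := Ideal.Quotient.eq_zero_iff_mem.mp h0
      obtain ⟨t, ht⟩ := Ideal.mem_span_singleton'.mp this
      refine not_dvd_of_span_pair_eq hdimO (X := φ Y) (Y := φ X₀) (by rw [Set.pair_comm]; exact h𝔪O) ⟨φ t, ?_⟩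
      rw [← map_mul, mul_comm, ht]
    have hπ : Prime (mk₂ X₀) := (Ideal.span_singleton_prime hπ0).mp hπI
    obtain ⟨w, hw⟩ := exists_dvd_of_prime_pow_succ_dvd hπ (s := mk₂ (↑c₃ * ↑s₂)) (ζ := mk₂ (z₀ ^ (n * ν)))
      (G := mk₂ g) (U := mk₂ (g₀ * (-u) ^ ν)) (M := k * ν) ((hdvd_iff _).not.mpr hs'P)
      ((hdvd_iff _).not.mpr fun h => hz₀P ((inferInstance : P.IsPrime).mem_of_pow_mem _ h)) (by
        have h1 : mk₂ ((↑c₃ * ↑s₂) * W) ∈ (Ideal.span ({Y, X₀ ^ (k * ν + 1)} : Set T)).map mk₂ :=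
          Ideal.mem_map_of_mem _ hs'W
        rw [map_span_pair, hY0, Ideal.span_insert_zero, Ideal.mem_span_singleton, map_pow] at h1
        have h2 : mk₂ ((↑c₃ * ↑s₂) * W) =
            mk₂ (↑c₃ * ↑s₂) * (mk₂ (z₀ ^ (n * ν)) * mk₂ g - mk₂ (g₀ * (-u) ^ ν) * mk₂ X₀ ^ (k * ν)) := by
          rw [hWdef]; simp only [map_mul, map_sub, map_pow]
        rwa [h2] at h1)
    obtain ⟨W₂, rfl⟩ := Ideal.Quotient.mk_surjective w
    have hmem : z₀ ^ (n * ν) * W₂ - g₀ * (-u) ^ ν ∈ P := by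
      rw [← hdvd_iff]; simpa only [map_sub, map_mul] using hw
    have hz𝔪 : z₀ ^ (n * ν) * W₂ ∈ maximalIdeal T :=
      Ideal.mul_mem_right _ _ (Ideal.pow_mem_of_mem _ hz₀𝔪 _ (Nat.mul_pos (by omega) (by omega)))
    have hunit : IsUnit (g₀ * (-u) ^ ν) := hg₀u.mul (huu.neg.pow ν)
    have hmem𝔪 : g₀ * (-u) ^ ν ∈ maximalIdeal T := by
      have : g₀ * (-u) ^ ν = z₀ ^ (n * ν) * W₂ - (z₀ ^ (n * ν) * W₂ - g₀ * (-u) ^ ν) := by ring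
      rw [this]; exact Ideal.sub_mem _ hz𝔪 (hPle hmem)
    exact (IsLocalRing.mem_maximalIdeal _).mp hmem𝔪 hunit

end Step

end Iota3

end Summit.ResolutionOfSingularities.ResolutionOfSingularities.Cruxes.HypersurfaceCentreConstruction.LocalEngine

end
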